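import Mathlib

/-!
# K-DEGEN: the admissible prime ideals are exactly those through the umbrella cone `V(X, N)`
[OURS · L1 W4.3 · crux `WeightedConstruction` stmt-ResolutionOfSingularities-0571 · NEGATIVE-SIDE helper
(frame-free admissibility criterion behind the T-KD analysis of res-L1-w43-tri-1 §20.11 / res-L1-w43-tri-2 §v10 D22 L-adm);
AI-drafted, AI review weaker than expert review; not a statement of any manuscript.]

For `𝔨_deg = X₀² + X₁·X₂⁴ + X₁³·X₃⁴·X₄⁴` over a commutative ring of characteristic `2` we record, def-free:
* `𝔨_deg = X₀² + X₁·N²` with `N = X₂² + X₁·X₃²·X₄²` (the «umbrella» form);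
* the Jacobian: `∂₁ 𝔨_deg = N²` and `∂ᵢ 𝔨_deg = 0` for `i ≠ 1`;
* a derivation maps `I²` into `I`;
* hence for a PRIME ideal `P` of the polynomial ring: `𝔨_deg ∈ P² ↔ X₀ ∈ P ∧ N ∈ P`, i.e. the weighted centres
  admissible for `𝔨_deg` (order ≥ 2 along the centre) are exactly the regular primes containing `(X₀, N)` — in every frame.
-/

open MvPolynomial

set_option linter.dupNamespace false
set_option autoImplicit false

namespace Summit.ResolutionOfSingularities.ResolutionOfSingularities.Theorems.WeightedConstruction.Negative.KDegAdmissiblePrimes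

variable {R : Type*} [CommRing R]

/-- A derivation maps `I²` into `I` (Leibniz). -/
theorem derivation_apply_mem_of_mem_sq {A : Type*} [CommRing A] [Algebra R A]
    (D : Derivation R A A) (I : Ideal A) {x : A} (hx : x ∈ I ^ 2) : D x ∈ I := by
  rw [pow_two] at hx
  refine Submodule.mul_induction_on hx ?_ ?_
  · intro a ha b hb
    rw [Derivation.leibniz, smul_eq_mul, smul_eq_mul]
    exact I.add_mem (I.mul_mem_right _ ha) (I.mul_mem_right _ hb)
  · intro x y hx hy
    rw [map_add]
    exact I.add_mem hx hy

/-- The umbrella form of K-DEGEN in characteristic 2: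
`X₀² + X₁X₂⁴ + X₁³X₃⁴X₄⁴ = X₀² + X₁·(X₂² + X₁X₃²X₄²)²`. -/
theorem kdeg_eq_umbrella [CharP R 2] :
    (X 0 ^ 2 + X 1 * X 2 ^ 4 + X 1 ^ 3 * X 3 ^ 4 * X 4 ^ 4 : MvPolynomial (Fin 5) R)
      = X 0 ^ 2 + X 1 * (X 2 ^ 2 + X 1 * X 3 ^ 2 * X 4 ^ 2) ^ 2 := by
  have h2 : (2 : MvPolynomial (Fin 5) R) = 0 := CharTwo.two_eq_zero
  have : (X 0 ^ 2 + X 1 * (X 2 ^ 2 + X 1 * X 3 ^ 2 * X 4 ^ 2) ^ 2 : MvPolynomial (Fin 5) R)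
      = X 0 ^ 2 + X 1 * X 2 ^ 4 + X 1 ^ 3 * X 3 ^ 4 * X 4 ^ 4
        + 2 * (X 1 ^ 2 * X 2 ^ 2 * X 3 ^ 2 * X 4 ^ 2) := by ring
  rw [this, h2, zero_mul, add_zero]

/-- Jacobian of K-DEGEN in characteristic 2, the `X₁`-direction: `∂₁ 𝔨_deg = N²`. -/
theorem pderiv_one_kdeg [CharP R 2] :
    pderiv 1 (X 0 ^ 2 + X 1 * X 2 ^ 4 + X 1 ^ 3 * X 3 ^ 4 * X 4 ^ 4 : MvPolynomial (Fin 5) R)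
      = (X 2 ^ 2 + X 1 * X 3 ^ 2 * X 4 ^ 2) ^ 2 := by
  have h2 : (2 : MvPolynomial (Fin 5) R) = 0 := CharTwo.two_eq_zero
  have h : pderiv 1 (X 0 ^ 2 + X 1 * X 2 ^ 4 + X 1 ^ 3 * X 3 ^ 4 * X 4 ^ 4 : MvPolynomial (Fin 5) R)
      = (X 2 ^ 2 + X 1 * X 3 ^ 2 * X 4 ^ 2) ^ 2
        + 2 * (X 1 ^ 2 * X 3 ^ 4 * X 4 ^ 4 - X 1 * X 2 ^ 2 * X 3 ^ 2 * X 4 ^ 2) := by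
    simp only [map_add, Derivation.leibniz, Derivation.leibniz_pow, pderiv_X_self, smul_eq_mul,
      nsmul_eq_mul]
    rw [pderiv_X_of_ne (i := (1 : Fin 5)) (j := 0) (by decide),
      pderiv_X_of_ne (i := (1 : Fin 5)) (j := 2) (by decide),
      pderiv_X_of_ne (i := (1 : Fin 5)) (j := 3) (by decide),
      pderiv_X_of_ne (i := (1 : Fin 5)) (j := 4) (by decide)]
    push_cast
    ring
  rw [h, h2, zero_mul, add_zero]

/-- Jacobian of K-DEGEN in characteristic 2, the other directions vanish: `∂ᵢ 𝔨_deg = 0` for `i ≠ 1`. -/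
theorem pderiv_kdeg_of_ne_one [CharP R 2] (i : Fin 5) (hi : i ≠ 1) :
    pderiv i (X 0 ^ 2 + X 1 * X 2 ^ 4 + X 1 ^ 3 * X 3 ^ 4 * X 4 ^ 4 : MvPolynomial (Fin 5) R) = 0 := by
  have h2 : (2 : MvPolynomial (Fin 5) R) = 0 := CharTwo.two_eq_zero
  have h4 : (4 : MvPolynomial (Fin 5) R) = 0 := by
    have : (4 : MvPolynomial (Fin 5) R) = 2 * 2 := by norm_num
    rw [this, h2, mul_zero]
  have hX1 : pderiv i (X 1 : MvPolynomial (Fin 5) R) = 0 := pderiv_X_of_ne (Ne.symm hi)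
  simp only [map_add, Derivation.leibniz, Derivation.leibniz_pow, hX1, smul_eq_mul, nsmul_eq_mul,
    mul_zero, add_zero, smul_zero]
  -- the remaining terms carry the factors 2 and 4
  push_cast
  simp only [h2, h4, zero_mul, mul_zero, add_zero]

/-- **Admissibility criterion (frame-free).** For a prime ideal `P` of `R[X₀,…,X₄]`, `char R = 2`:
`𝔨_deg ∈ P²  ↔  X₀ ∈ P ∧ N ∈ P` (`N = X₂² + X₁X₃²X₄²`). -/
theorem kdeg_mem_sq_iff [CharP R 2] (P : Ideal (MvPolynomial (Fin 5) R)) [hP : P.IsPrime] :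
    (X 0 ^ 2 + X 1 * X 2 ^ 4 + X 1 ^ 3 * X 3 ^ 4 * X 4 ^ 4 : MvPolynomial (Fin 5) R) ∈ P ^ 2
      ↔ (X 0 : MvPolynomial (Fin 5) R) ∈ P ∧ (X 2 ^ 2 + X 1 * X 3 ^ 2 * X 4 ^ 2 : MvPolynomial (Fin 5) R) ∈ P := by
  constructor
  · intro hf
    -- `N² = ∂₁ 𝔨_deg ∈ P`
    have hN2 : ((X 2 ^ 2 + X 1 * X 3 ^ 2 * X 4 ^ 2) ^ 2 : MvPolynomial (Fin 5) R) ∈ P := by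
      rw [← pderiv_one_kdeg]
      exact derivation_apply_mem_of_mem_sq (pderiv 1) P hf
    have hN : (X 2 ^ 2 + X 1 * X 3 ^ 2 * X 4 ^ 2 : MvPolynomial (Fin 5) R) ∈ P :=
      hP.mem_of_pow_mem 2 hN2
    refine ⟨?_, hN⟩
    -- `X₀² = 𝔨_deg - X₁ N² ∈ P`
    have hf1 : (X 0 ^ 2 + X 1 * X 2 ^ 4 + X 1 ^ 3 * X 3 ^ 4 * X 4 ^ 4 : MvPolynomial (Fin 5) R) ∈ P :=
      Ideal.pow_le_self two_ne_zero hf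
    rw [kdeg_eq_umbrella] at hf1
    have hX02 : (X 0 ^ 2 : MvPolynomial (Fin 5) R) ∈ P := by
      have := P.sub_mem hf1 (P.mul_mem_left (X 1) (P.mul_mem_left (X 2 ^ 2 + X 1 * X 3 ^ 2 * X 4 ^ 2) hN))
      simpa [pow_two, mul_assoc] using this
    exact hP.mem_of_pow_mem 2 hX02
  · rintro ⟨hX, hN⟩
    rw [kdeg_eq_umbrella, pow_two P]
    refine (P * P).add_mem (by rw [pow_two]; exact Ideal.mul_mem_mul hX hX) ?_
    have : (X 1 * (X 2 ^ 2 + X 1 * X 3 ^ 2 * X 4 ^ 2) ^ 2 : MvPolynomial (Fin 5) R)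
        = (X 1 * (X 2 ^ 2 + X 1 * X 3 ^ 2 * X 4 ^ 2)) * (X 2 ^ 2 + X 1 * X 3 ^ 2 * X 4 ^ 2) := by ring
    rw [this]
    exact Ideal.mul_mem_mul (P.mul_mem_left _ hN) hN

/-- Corollary: a prime not containing `X₀` is never admissible for K-DEGEN. -/
theorem kdeg_not_mem_sq_of_X_not_mem [CharP R 2] (P : Ideal (MvPolynomial (Fin 5) R)) [P.IsPrime]
    (hX : (X 0 : MvPolynomial (Fin 5) R) ∉ P) :
    (X 0 ^ 2 + X 1 * X 2 ^ 4 + X 1 ^ 3 * X 3 ^ 4 * X 4 ^ 4 : MvPolynomial (Fin 5) R) ∉ P ^ 2 :=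
  fun h => hX ((kdeg_mem_sq_iff P).mp h).1

/-- Corollary: a prime not containing the umbrella equation `N` is never admissible for K-DEGEN
(e.g. every regular prime through the `X₁`-axis but transversal to `V(N)`). -/
theorem kdeg_not_mem_sq_of_N_not_mem [CharP R 2] (P : Ideal (MvPolynomial (Fin 5) R)) [P.IsPrime]
    (hN : (X 2 ^ 2 + X 1 * X 3 ^ 2 * X 4 ^ 2 : MvPolynomial (Fin 5) R) ∉ P) :
    (X 0 ^ 2 + X 1 * X 2 ^ 4 + X 1 ^ 3 * X 3 ^ 4 * X 4 ^ 4 : MvPolynomial (Fin 5) R) ∉ P ^ 2 :=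
  fun h => hN ((kdeg_mem_sq_iff P).mp h).2

end Summit.ResolutionOfSingularities.ResolutionOfSingularities.Theorems.WeightedConstruction.Negative.KDegAdmissiblePrimes
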